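import Summits.BirchSwinnertonDyer.BirchSwinnertonDyer.Theses.PAdicOrderV2

/-!
# BirchSwinnertonDyer / PAdicOrderV2 — crux #2 `PAdicOrderComparisonR2` (stmt-BirchSwinnertonDyer-0489):
# negative lemmas (standing disprover, cycle 1)

Load-bearing analysis of the crux
`∀ W [IsElliptic] [IsGloballyMinimal] p [Fact p.Prime], IsOrdinaryAt W p → ∀ {N} [NeZero N]
(f : CuspForm (Gamma0 N) 2), IsNewformOf W f → (padicLFunction f (unitRoot W p)).order = W.analyticRank`,
as kernel-checked theorems (no statement of the route is asserted positively):

* the two junk values of the tree's Mazur–Swinnerton-Dyer construction are located and shown to be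
  fenced off by the hypotheses: `L_p(0, α, T) = 0` for the ZERO cusp form
  (`pAdicOrderComparisonR2_padicLFunction_zero_form`) — excluded by `IsNewformOf` (`a₁ = 1`,
  `pAdicOrderComparisonR2_not_isNewformOf_zero`); and `L_p(f, 0, T) = 0` at the junk root `α = 0`
  (`pAdicOrderComparisonR2_padicLFunction_zero_root`), which is the value of `unitRoot W p` as soon
  as `p ∣ a_p(W)` (`pAdicOrderComparisonR2_unitRoot_eq_zero_of_dvd_frobeniusTrace`) — excluded by
  `IsOrdinaryAt` (Hensel, `unitRoot_spec_holds`);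
* hence the hypothesis `IsNewformOf W f` is LOAD-BEARING: the crux with it dropped is false
  (`pAdicOrderComparisonR2_false_without_isNewformOf`; witness `f = 0 ∈ S₂(Γ₀(1))` on a good
  ordinary `(W, p)`, which exists in Lean: a global minimal model of `y² + y = x³ - x` and a good
  ordinary prime `p ≥ 5` from `exists_good_ordinary_prime_holds`,
  `pAdicOrderComparisonR2_exists_isOrdinaryAt` — also a NON-VACUITY witness for the `(W, p)`-part of
  the crux's hypotheses);
* and `IsOrdinaryAt W p` is load-bearing modulo one modular curve with a prime `p ∣ a_p`
  (`pAdicOrderComparisonR2_false_without_isOrdinaryAt_of`): modularity of a single curve is not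
  constructible in the tree (`exists_isNewformOf` is cite-only), so this stays an implication.

Nothing here refutes the crux; see `Cruxes/PAdicOrderComparisonR2/Disproof.lean` for the full
adversarial record (why it resists, `p = 2`, the numerics).
-/

set_option linter.dupNamespace false

namespace Summit.BirchSwinnertonDyer.BirchSwinnertonDyer.Theorems

open scoped MatrixGroups ModularForm
open Filter Topology CongruenceSubgroup
open Literature.NumberTheory.EllipticCurves Literature.NumberTheory.EllipticCurves.ModularForms

section JunkValues

variable {N : ℕ} {p : ℕ} [Fact p.Prime]

omit [Fact p.Prime] in
/-- The rational plus symbol `[r]⁺` of the zero form is `0` (the modular symbol is the integral of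
`0`, and `0 / Ω⁺ = 0`). [folklore] -/
theorem pAdicOrderComparisonR2_ratPlusSymbol_zero_form (r : ℚ) :
    ratPlusSymbol (0 : CuspForm (Gamma0 N) 2) r = 0 := by
  have h0 : normalizedPlusSymbol (0 : CuspForm (Gamma0 N) 2) r = 0 := by
    simp [normalizedPlusSymbol, plusSymbol, modularSymbol]
  unfold ratPlusSymbol
  have h : ∃ q : ℚ, (q : ℝ) = normalizedPlusSymbol (0 : CuspForm (Gamma0 N) 2) r := ⟨0, by simp [h0]⟩
  rw [dif_pos h]
  have h2 : ((h.choose : ℚ) : ℝ) = 0 := h.choose_spec.trans h0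
  exact_mod_cast h2

/-- **Junk value 1.** The `p`-adic `L`-function of the ZERO cusp form is the zero power series, for
every `α` (measure `0`, Riemann sums `0`, `limUnder` of the constant sequence); its `T`-order is
`⊤ ≠ ↑r_an`. (Mazur–Tate–Teitelbaum 1986, §I.10–I.13 for the construction.)
[cite: MazurTateTeitelbaum1986Invent, §I.10–I.13] -/
theorem pAdicOrderComparisonR2_padicLFunction_zero_form (α : ℚ_[p]) :
    padicLFunction (0 : CuspForm (Gamma0 N) 2) α = 0 := by
  have hμ : ∀ (n : ℕ) (a : ZMod (p ^ n)), msdMeasure (0 : CuspForm (Gamma0 N) 2) α n a = 0 := by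
    intro n a
    cases n <;> simp [msdMeasure, pAdicOrderComparisonR2_ratPlusSymbol_zero_form]
  have hR : ∀ k : ℕ, padicLRiemannSum (0 : CuspForm (Gamma0 N) 2) α k = fun _ => 0 := by
    intro k
    funext n
    simp [padicLRiemannSum, hμ]
  ext k
  simp only [coeff_padicLFunction, map_zero]
  unfold padicLCoeff
  rw [hR k]
  exact tendsto_const_nhds.limUnder_eq

/-- **Junk value 2.** `L_p(f, 0, T) = 0` for EVERY cusp form `f`: at the junk root `α = 0` the
measure vanishes at all levels `≥ 1` (`0⁻¹ = 0` in Lean) and the Riemann sums live at level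
`n + e₀ ≥ 1`. [cite: MazurTateTeitelbaum1986Invent, §I.10 (10.1)] -/
theorem pAdicOrderComparisonR2_padicLFunction_zero_root (f : CuspForm (Gamma0 N) 2) :
    padicLFunction f (0 : ℚ_[p]) = 0 := by
  have hμ : ∀ {m : ℕ} (_ : m ≠ 0) (a : ZMod (p ^ m)), msdMeasure f (0 : ℚ_[p]) m a = 0 := by
    intro m hm a
    obtain ⟨n, rfl⟩ := Nat.exists_eq_succ_of_ne_zero hm
    simp [msdMeasure]
  have he : 1 ≤ cyclotomicExponent p := by
    unfold cyclotomicExponent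
    split_ifs <;> norm_num
  have hR : ∀ k : ℕ, padicLRiemannSum f (0 : ℚ_[p]) k = fun _ => 0 := by
    intro k
    funext n
    have hm : n + cyclotomicExponent p ≠ 0 := by omega
    simp [padicLRiemannSum, hμ hm]
  ext k
  simp only [coeff_padicLFunction, map_zero]
  unfold padicLCoeff
  rw [hR k]
  exact tendsto_const_nhds.limUnder_eq

/-- **Where junk value 2 is the tree's `L_p(E, T)`.** If `p ∣ a_p(W)` (every supersingular prime
`p ≥ 5`, every additive prime, `a_p ∈ {0, ±p}`-cases at `p = 2, 3`) then `X² - a_p X + p` has no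
unit root in `ℤ_p` — a unit root `u` would give `‖u²‖ = 1 = ‖a_p u - p‖ < 1` — so
`unitRoot W p = 0` (its junk branch). Complement of Hensel's lemma at ordinary `p`
(Mazur–Tate–Teitelbaum 1986, §I.11, "allowable root"). [cite: MazurTateTeitelbaum1986Invent, §I.11] -/
theorem pAdicOrderComparisonR2_unitRoot_eq_zero_of_dvd_frobeniusTrace (W : WeierstrassCurve ℚ)
    [W.IsGloballyMinimal] (p : ℕ) [Fact p.Prime] (hdvd : (p : ℤ) ∣ W.frobeniusTrace p) :
    unitRoot W p = 0 := by
  classical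
  unfold unitRoot
  rw [dif_neg]
  rintro ⟨α, ⟨hα, hu⟩, -⟩
  have hαn : ‖α‖ = 1 := PadicInt.isUnit_iff.mp hu
  have ha : ‖(W.frobeniusTrace p : ℤ_[p])‖ < 1 := (PadicInt.norm_int_lt_one_iff_dvd _).mpr hdvd
  have hp : ‖(p : ℤ_[p])‖ < 1 := by
    rw [PadicInt.norm_p]
    exact inv_lt_one_of_one_lt₀ (by exact_mod_cast (Fact.out : p.Prime).one_lt)
  have heq : α ^ 2 = (W.frobeniusTrace p : ℤ_[p]) * α + -(p : ℤ_[p]) := by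
    linear_combination hα
  have h1 : ‖α ^ 2‖ = 1 := by rw [norm_pow, hαn, one_pow]
  have h2 : ‖(W.frobeniusTrace p : ℤ_[p]) * α + -(p : ℤ_[p])‖ < 1 := by
    refine lt_of_le_of_lt (PadicInt.nonarchimedean _ _) (max_lt ?_ ?_)
    · rw [norm_mul, hαn, mul_one]; exact ha
    · rw [norm_neg]; exact hp
  rw [← heq, h1] at h2
  exact lt_irrefl _ h2

/-- **Junk value 1 is fenced off by `IsNewformOf`.** The zero form is not the newform of any curve:
`IsNewform0` asks `a₁ = 1`, while the `q`-expansion of `0` is `0` (Diamond–Shurman Def. 5.8.1).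
[folklore] -/
theorem pAdicOrderComparisonR2_not_isNewformOf_zero [NeZero N] (W : WeierstrassCurve ℚ) :
    ¬ IsNewformOf W (0 : CuspForm (Gamma0 N) 2) := by
  rintro ⟨⟨-, -, hnorm⟩, -⟩
  unfold IsNormalized at hnorm
  have h0 : (⇑(0 : CuspForm (Gamma0 N) 2) : UpperHalfPlane → ℂ) = 0 := rfl
  rw [h0, UpperHalfPlane.qExpansion_zero, map_zero] at hnorm
  exact zero_ne_one hnorm

end JunkValues

section LoadBearing

/-- **Non-vacuity of the `(W, p)`-hypotheses, in Lean.** There is a globally minimal elliptic curve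
over `ℚ` with a good ordinary prime `p ≥ 5`: a global minimal model (Néron; Silverman AEC VIII.8.3,
tree theorem `hasGlobalMinimalModel_rat_holds`) of `y² + y = x³ - x` (`Δ = 37`), and a good
ordinary prime from `exists_good_ordinary_prime_holds` (Serre 1981, §8). [cite: Serre1981, §8] -/
theorem pAdicOrderComparisonR2_exists_isOrdinaryAt :
    ∃ (W : WeierstrassCurve ℚ) (_ : W.IsElliptic) (_ : W.IsGloballyMinimal) (p : ℕ) (_ : Fact p.Prime),
      5 ≤ p ∧ IsOrdinaryAt W p := by
  let E : WeierstrassCurve ℚ := ⟨0, 0, 1, -1, 0⟩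
  haveI hE : E.IsElliptic := ⟨by
    rw [isUnit_iff_ne_zero]
    simp only [E, WeierstrassCurve.Δ, WeierstrassCurve.b₂, WeierstrassCurve.b₄, WeierstrassCurve.b₆,
      WeierstrassCurve.b₈]
    norm_num⟩
  obtain ⟨C, hC⟩ := WeierstrassCurve.hasGlobalMinimalModel_rat_holds E
  obtain ⟨p, hp, h5, hgood, hap⟩ := WeierstrassCurve.exists_good_ordinary_prime_holds (C • E)
  exact ⟨C • E, inferInstance, hC, p, hp, h5, hgood, hap⟩

/-- **`IsNewformOf` is load-bearing: the crux `PAdicOrderComparisonR2` with the newform hypothesis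
DROPPED is false.** Witness: any good ordinary `(W, p)`
(`pAdicOrderComparisonR2_exists_isOrdinaryAt`) and `f = 0 ∈ S₂(Γ₀(1))`, whose `p`-adic
`L`-function is `0` (`pAdicOrderComparisonR2_padicLFunction_zero_form`), of `T`-order `⊤ ≠ ↑r_an(W)`.
So any proof of the crux uses the newform hypothesis beyond typing — at least through
`L_p(E, T) ≠ 0` (Rohrlich 1984; tree theorem `padicLFunction_ne_zero_holds`).
[cite: RohrlichInventiones1984, Theorem (p. 409)] -/
theorem pAdicOrderComparisonR2_false_without_isNewformOf :
    ¬ (∀ (W : WeierstrassCurve ℚ) [W.IsElliptic] [W.IsGloballyMinimal] (p : ℕ) [Fact p.Prime],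
        IsOrdinaryAt W p → ∀ {N : ℕ} [NeZero N] (f : CuspForm (Gamma0 N) 2),
          (padicLFunction f (unitRoot W p : ℚ_[p])).order = W.analyticRank) := by
  intro h
  obtain ⟨W, _, _, p, _, -, hord⟩ := pAdicOrderComparisonR2_exists_isOrdinaryAt
  have h1 := h W p hord (N := 1) (0 : CuspForm (Gamma0 1) 2)
  rw [pAdicOrderComparisonR2_padicLFunction_zero_form, PowerSeries.order_zero] at h1
  exact ENat.coe_ne_top _ h1.symm

/-- **`IsOrdinaryAt` is load-bearing, modulo one modular curve with a non-ordinary prime.** If some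
globally minimal elliptic `W / ℚ` has a newform `f` (modularity of ONE curve; Breuil–Conrad–Diamond–
Taylor 2001, Thm. A — not constructible in the tree, `exists_isNewformOf` is cite-only) and a prime
`p ∣ a_p(W)` (e.g. 11a1 at `p = 2`; infinitely many supersingular primes exist for every `E/ℚ`,
Elkies 1987), then the crux with `IsOrdinaryAt` dropped fails at `(W, p, f)`: `unitRoot W p = 0`,
so the tree's `L_p` is the zero series, of `T`-order `⊤ ≠ ↑r_an(W)`.
[cite: BCDTJAMS2001, Theorem A] -/
theorem pAdicOrderComparisonR2_false_without_isOrdinaryAt_of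
    (hex : ∃ (W : WeierstrassCurve ℚ) (_ : W.IsElliptic) (_ : W.IsGloballyMinimal) (p : ℕ)
      (_ : Fact p.Prime) (N : ℕ) (_ : NeZero N) (f : CuspForm (Gamma0 N) 2),
      IsNewformOf W f ∧ (p : ℤ) ∣ W.frobeniusTrace p) :
    ¬ (∀ (W : WeierstrassCurve ℚ) [W.IsElliptic] [W.IsGloballyMinimal] (p : ℕ) [Fact p.Prime],
        ∀ {N : ℕ} [NeZero N] (f : CuspForm (Gamma0 N) 2), IsNewformOf W f →
          (padicLFunction f (unitRoot W p : ℚ_[p])).order = W.analyticRank) := by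
  intro h
  obtain ⟨W, _, _, p, _, N, _, f, hf, hdvd⟩ := hex
  have h1 := h W p f hf
  rw [pAdicOrderComparisonR2_unitRoot_eq_zero_of_dvd_frobeniusTrace W p hdvd, PadicInt.coe_zero,
    pAdicOrderComparisonR2_padicLFunction_zero_root, PowerSeries.order_zero] at h1
  exact ENat.coe_ne_top _ h1.symm

end LoadBearing

end Summit.BirchSwinnertonDyer.BirchSwinnertonDyer.Theorems
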